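import Summits.KontsevichZagierPeriods.KontsevichZagierPeriods.Theorems.SoloInformedParamTerm
import Summits.KontsevichZagierPeriods.KontsevichZagierPeriods.Theorems.SoloInformedSemialgebraicFibreLogic
import HarnessLib

/-!
# Coincidence clauses, constant terms and the rectangle term

First-order clauses on the parameters of parametrised terms (`SoloInformedPTerm`), used by the
kernel THEOREM R / THEOREM T for bounded `KZ_ℝ` chains:

* `T.SoloInformedCoin T' p` — the terms `T`, `T'` (same dimension) have the same domain fibre at `p`
  and the graph of `T` over it lies in the graph of `T'`; it is a `ℚ`-SEMIALGEBRAIC condition on `p`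
  (`isSemialgebraic_setOf_coin`), it holds when the denoted representations are equal
  (`coin_of_rep_eq`), and it forces equal domains, integrands equal on the domain and equal values
  (`rep_congr_of_coin`, `value_eq_of_coin`);
* `castDim` — transport of a term along an equality of dimensions (all lemmas by `subst`);
* `const K r` — the constant term denoting the base change of a bounded `ℚ`-representation `r` at
  every parameter (`rep_const`); a term coinciding with a constant term at `p` and equal to it at
  `p₀` denotes at `p` what it denotes at `p₀` (`rep_eq_of_coin_const`);
* `rectTerm kℓ` — the term denoting the rectangle `[[0,1] × [0, p kℓ], 1]` (`rep_rectTerm`).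

References: [cite: KontsevichZagier2001, §1.1–1.2]; [cite: BochnakCosteRoy1998, Prop. 2.2.4].
-/

noncomputable section

open Set MeasureTheory MvPolynomial Literature.ModelTheory.ExponentialFields
  Literature.NumberTheory.Transcendental

namespace Summit.KontsevichZagierPeriods.KontsevichZagierPeriods.Theorems

/-- Representations with the same domain and integrands equal on it have the same value.
[cite: KontsevichZagier2001, §1.1] -/
theorem soloInformed_value_congr {n : ℕ} {r s : KZOver.IntegralRep ℝ n} (hd : r.domain = s.domain)
    (hi : EqOn r.integrand s.integrand r.domain) : r.value = s.value := by
  unfold KZOver.IntegralRep.value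
  rw [← hd]
  exact setIntegral_congr_fun r.measurableSet_domain hi

namespace SoloInformedPTerm

variable {K : Type} {d d' : ℕ}

/-! ### Coincidence of two terms at a parameter -/

/-- **Coincidence clause**: same domain fibre, and the graph of `T` over it lies in the graph of
`T'`. [cite: BochnakCosteRoy1998, Prop. 2.2.4] -/
def SoloInformedCoin (T T' : SoloInformedPTerm K d) (p : K → ℝ) : Prop :=
  (∀ x, x ∈ T.fibre p ↔ x ∈ T'.fibre p) ∧
    ∀ z : Fin (d + 1) → ℝ, Fin.init z ∈ T.fibre p → z ∈ T.gfibre p → z ∈ T'.gfibre p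

/-- Reindexing identity behind `Fin.init` of a joint point. [cite: BochnakCosteRoy1998, §2.2] -/
theorem sumElim_comp_sumMap_castSucc (p : K → ℝ) (z : Fin (d + 1) → ℝ) :
    Sum.elim p z ∘ Sum.map id Fin.castSucc = Sum.elim p (Fin.init z) := by
  rw [Sum.elim_comp_map, Function.comp_id]
  rfl

/-- **The coincidence clause is `ℚ`-semialgebraic in the parameter.**
[cite: BochnakCosteRoy1998, Prop. 2.2.4] -/
theorem isSemialgebraic_setOf_coin [Finite K] (T T' : SoloInformedPTerm K d) :
    IsSemialgebraic ℚ {p : K → ℝ | T.SoloInformedCoin T' p} := by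
  refine soloInformed_isSemialgebraic_setOf_and ?_ ?_
  · exact soloInformed_isSemialgebraic_setOf_forall_fibre (T := {w | w ∈ T.S ↔ w ∈ T'.S})
      (soloInformed_isSemialgebraic_setOf_iff T.hS T'.hS) fun p x => Iff.rfl
  · refine soloInformed_isSemialgebraic_setOf_forall_fibre
      (T := {w | w ∘ Sum.map id Fin.castSucc ∈ T.S → w ∈ T.G → w ∈ T'.G})
      (soloInformed_isSemialgebraic_setOf_imp (T.hS.preimage_comp _)
        (soloInformed_isSemialgebraic_setOf_imp T.hG T'.hG)) fun p z => ?_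
    simp only [mem_setOf_eq, sumElim_comp_sumMap_castSucc, mem_fibre, mem_gfibre]

/-- Coincidence is reflexive. [cite: BochnakCosteRoy1998, §2.2] -/
theorem coin_refl (T : SoloInformedPTerm K d) (p : K → ℝ) : T.SoloInformedCoin T p :=
  ⟨fun _ => Iff.rfl, fun _ _ h => h⟩

variable {T T' : SoloInformedPTerm K d} {p p₀ : K → ℝ}

/-- Coinciding terms have the same fibre. [cite: BochnakCosteRoy1998, §2.2] -/
theorem fibre_eq_of_coin (h : T.SoloInformedCoin T' p) : T.fibre p = T'.fibre p :=
  Set.ext h.1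

/-- Coinciding functional terms have the same graph values on the fibre.
[cite: BochnakCosteRoy1998, §2.2] -/
theorem gval_eq_of_coin (h : T.SoloInformedCoin T' p) (hT : T.SoloInformedFunctional p)
    (hT' : T'.SoloInformedFunctional p) {x : Fin d → ℝ} (hx : x ∈ T.fibre p) :
    T.gval p x = T'.gval p x := by
  have hz := h.2 (Fin.snoc x (T.gval p x)) (by rwa [Fin.init_snoc]) (snoc_gval_mem hT hx)
  exact (gval_eq hT' ((h.1 x).1 hx) hz).symm

/-- Coinciding functional terms have hybrid integrands equal on the fibre.
[cite: KontsevichZagier2001, §1.1] -/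
theorem hybrid_eqOn_of_coin (h : T.SoloInformedCoin T' p) (hT : T.SoloInformedFunctional p)
    (hT' : T'.SoloInformedFunctional p) : EqOn (T.hybrid p) (T'.hybrid p) (T.fibre p) :=
  fun x hx => by
    rw [hybrid_of_mem hx, hybrid_of_mem ((h.1 x).1 hx), gval_eq_of_coin h hT hT' hx]

/-- **Coinciding admissible terms denote representations with the same domain and integrands
equal on it.** [cite: KontsevichZagier2001, §1.1] -/
theorem rep_congr_of_coin (h : T.SoloInformedCoin T' p) (hT : T.SoloInformedAdm p)
    (hT' : T'.SoloInformedAdm p) :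
    (T.rep p).domain = (T'.rep p).domain ∧
      EqOn (T.rep p).integrand (T'.rep p).integrand (T.rep p).domain := by
  rw [rep_domain hT, rep_domain hT', rep_integrand hT, rep_integrand hT']
  exact ⟨fibre_eq_of_coin h, hybrid_eqOn_of_coin h hT.1 hT'.1⟩

/-- Coinciding admissible terms denote representations with the same value.
[cite: KontsevichZagier2001, §1.1] -/
theorem value_eq_of_coin (h : T.SoloInformedCoin T' p) (hT : T.SoloInformedAdm p)
    (hT' : T'.SoloInformedAdm p) : (T.rep p).value = (T'.rep p).value :=
  soloInformed_value_congr (rep_congr_of_coin h hT hT').1 (rep_congr_of_coin h hT hT').2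

/-- **Equal denotations force coincidence.** [cite: KontsevichZagier2001, §1.1] -/
theorem coin_of_rep_eq (hT : T.SoloInformedAdm p) (hT' : T'.SoloInformedAdm p)
    (h : T.rep p = T'.rep p) : T.SoloInformedCoin T' p := by
  have hfib : T.fibre p = T'.fibre p := by rw [← rep_domain hT, ← rep_domain hT', h]
  refine ⟨fun x => by rw [hfib], fun z hz hzG => ?_⟩
  have hx' : Fin.init z ∈ T'.fibre p := hfib ▸ hz
  have h1 : T.gval p (Fin.init z) = z (Fin.last d) :=
    gval_eq hT.1 hz (t := z (Fin.last d)) (by rwa [Fin.snoc_init_self])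
  have h2 : T.gval p (Fin.init z) = T'.gval p (Fin.init z) := by
    rw [← hybrid_of_mem hz, ← hybrid_of_mem hx', ← rep_integrand hT, ← rep_integrand hT', h]
  have h3 := snoc_gval_mem hT'.1 hx'
  rwa [← h2, h1, Fin.snoc_init_self] at h3

/-- **One term at two parameters**: equal fibres and equal graph values on them force equal
denotations (the ambient function is shared). [cite: KontsevichZagier2001, §1.1] -/
theorem rep_eq_rep_of_fibre_eq (h : T.SoloInformedAdm p) (h₀ : T.SoloInformedAdm p₀)
    (hfib : T.fibre p = T.fibre p₀) (hg : ∀ x ∈ T.fibre p, T.gval p x = T.gval p₀ x) :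
    T.rep p = T.rep p₀ := by
  refine KZOver.IntegralRep.ext (by rw [rep_domain h, rep_domain h₀, hfib]) ?_
  rw [rep_integrand h, rep_integrand h₀]
  funext x
  by_cases hx : x ∈ T.fibre p
  · rw [hybrid_of_mem hx, hybrid_of_mem (hfib ▸ hx), hg x hx]
  · rw [hybrid_of_not_mem hx, hybrid_of_not_mem (hfib ▸ hx)]

/-- **Pinning by a rigid term.** If `C` has the same fibre and graph values at `p` and `p₀`, `T`
denotes at `p₀` what `C` does, and `T` coincides with `C` at `p`, then `T` denotes at `p` what it
denotes at `p₀`. [cite: KontsevichZagier2001, §1.1] -/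
theorem rep_eq_of_coin_rigid {C : SoloInformedPTerm K d} (hT : T.SoloInformedAdm p)
    (hT₀ : T.SoloInformedAdm p₀) (hC : C.SoloInformedAdm p) (hC₀ : C.SoloInformedAdm p₀)
    (hCfib : C.fibre p = C.fibre p₀) (hCg : ∀ x ∈ C.fibre p, C.gval p x = C.gval p₀ x)
    (h₀ : T.rep p₀ = C.rep p₀) (h : T.SoloInformedCoin C p) : T.rep p = T.rep p₀ := by
  have hc₀ : T.SoloInformedCoin C p₀ := coin_of_rep_eq hT₀ hC₀ h₀
  have hfib : T.fibre p = T.fibre p₀ := by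
    rw [fibre_eq_of_coin h, hCfib, ← fibre_eq_of_coin hc₀]
  refine rep_eq_rep_of_fibre_eq hT hT₀ hfib fun x hx => ?_
  have hxC : x ∈ C.fibre p := (h.1 x).1 hx
  rw [gval_eq_of_coin h hT.1 hC.1 hx, hCg x hxC, gval_eq_of_coin hc₀ hT₀.1 hC₀.1 (hfib ▸ hx)]

/-! ### Transport along an equality of dimensions -/

/-- Transport of a term along `d = d'`. [cite: BochnakCosteRoy1998, §2.2] -/
def castDim (h : d = d') (T : SoloInformedPTerm K d) : SoloInformedPTerm K d' := h ▸ T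

/-- The transported term denotes the same generator. [cite: KontsevichZagier2001, §1.2] -/
theorem sigma_rep_castDim (h : d = d') (T : SoloInformedPTerm K d) (p : K → ℝ) :
    (⟨d', (castDim h T).rep p⟩ : Σ n, KZOver.IntegralRep ℝ n) = ⟨d, T.rep p⟩ := by
  subst h
  rfl

/-- Transport preserves admissibility. [cite: KontsevichZagier2001, §1.1] -/
theorem adm_castDim_iff (h : d = d') (T : SoloInformedPTerm K d) (p : K → ℝ) :
    (castDim h T).SoloInformedAdm p ↔ T.SoloInformedAdm p := by
  subst h
  exact Iff.rfl

/-- Transport preserves the value of the denotation. [cite: KontsevichZagier2001, §1.1] -/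
theorem value_rep_castDim (h : d = d') (T : SoloInformedPTerm K d) (p : K → ℝ) :
    ((castDim h T).rep p).value = (T.rep p).value := by
  subst h
  rfl

/-- Transport of a representation along `n = n'`. [cite: KontsevichZagier2001, §1.1] -/
def castRep {k : Type*} [CommRing k] [Algebra k ℝ] {n n' : ℕ} (h : n = n')
    (q : KZOver.IntegralRep k n) : KZOver.IntegralRep k n' := h ▸ q

/-- Transport does not change the generator. [cite: KontsevichZagier2001, §1.2] -/
theorem of_castRep {k : Type*} [CommRing k] [Algebra k ℝ] {n n' : ℕ} (h : n = n')
    (q : KZOver.IntegralRep k n) : KZOver.of (castRep h q) = KZOver.of q := by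
  subst h
  rfl

/-- Transport commutes with base change. [cite: KontsevichZagier2001, §1.1] -/
theorem baseChange_castRep {k : Type*} [CommRing k] [Algebra k ℝ] {n n' : ℕ} (h : n = n')
    (q : KZOver.IntegralRep k n) : (castRep h q).baseChange ℝ = castRep h (q.baseChange ℝ) := by
  subst h
  rfl

/-- Transported terms denote transported representations. [cite: KontsevichZagier2001, §1.1] -/
theorem rep_castDim (h : d = d') (T : SoloInformedPTerm K d) (p : K → ℝ) :
    (castDim h T).rep p = castRep h (T.rep p) := by
  subst h
  rfl

/-- **Equality of generators** `⟨n, a⟩ = ⟨n', b⟩` is transport.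
[cite: KontsevichZagier2001, §1.2] -/
theorem sigma_mk_eq_iff {k : Type*} [CommRing k] [Algebra k ℝ] {n n' : ℕ}
    (a : KZOver.IntegralRep k n) (b : KZOver.IntegralRep k n') :
    (⟨n, a⟩ : Σ m, KZOver.IntegralRep k m) = ⟨n', b⟩ ↔ ∃ h : n = n', castRep h a = b := by
  constructor
  · intro e
    cases e
    exact ⟨rfl, rfl⟩
  · rintro ⟨h, hb⟩
    subst h
    subst hb
    rfl

/-- Transported representations: same domain up to the (trivial) reindexing, read through
`castRep`. After `subst` this is literal. [cite: KontsevichZagier2001, §1.1] -/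
theorem castRep_eq_iff {k : Type*} [CommRing k] [Algebra k ℝ] {n n' : ℕ} (h : n = n')
    (a : KZOver.IntegralRep k n) (b : KZOver.IntegralRep k n') :
    castRep h a = b ↔ (castRep h (a.baseChange ℝ)) = b.baseChange ℝ := by
  subst h
  constructor
  · intro e
    subst e
    rfl
  · intro e
    have hd := congrArg KZOver.IntegralRep.domain e
    have hi := congrArg KZOver.IntegralRep.integrand e
    exact KZOver.IntegralRep.ext hd hi

/-! ### The constant term of a bounded rational representation -/

/-- **Constant term**: domain family `ℝ^K × r.domain`, graph family `ℝ^K × graph (r.integrand)`,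
ambient function `r.integrand`. [cite: KontsevichZagier2001, §1.1] -/
def const (K : Type) {n : ℕ} (r : KZOver.IntegralRep ℚ n) : SoloInformedPTerm K n where
  S := {w | w ∘ Sum.inr ∈ r.domain}
  G := {w | w ∘ Sum.inr ∈
    {z : Fin (n + 1) → ℝ | Fin.init z ∈ r.domain ∧ z (Fin.last n) = r.integrand (Fin.init z)}}
  φ := r.integrand
  hS := r.isSemialgebraic_domain.preimage_comp Sum.inr
  hG := (isSemialgebraicFunOn_iff.1 r.isSemialgebraicFunOn_integrand).preimage_comp Sum.inr

variable {n : ℕ} (r : KZOver.IntegralRep ℚ n) (q : K → ℝ)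

/-- Fibres of the constant term. [cite: KontsevichZagier2001, §1.1] -/
@[simp] theorem fibre_const : (const K r).fibre q = r.domain := by
  ext x
  show Sum.elim q x ∘ Sum.inr ∈ r.domain ↔ x ∈ r.domain
  rw [Sum.elim_comp_inr]

/-- Graph fibres of the constant term. [cite: KontsevichZagier2001, §1.1] -/
theorem mem_gfibre_const (z : Fin (n + 1) → ℝ) : z ∈ (const K r).gfibre q ↔
    Fin.init z ∈ r.domain ∧ z (Fin.last n) = r.integrand (Fin.init z) := by
  show Sum.elim q z ∘ Sum.inr ∈ _ ↔ _
  rw [Sum.elim_comp_inr]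
  rfl

/-- Graph fibres of the constant term over a point of the domain.
[cite: KontsevichZagier2001, §1.1] -/
theorem snoc_mem_gfibre_const {x : Fin n → ℝ} (hx : x ∈ r.domain) (t : ℝ) :
    Fin.snoc x t ∈ (const K r).gfibre q ↔ t = r.integrand x := by
  rw [mem_gfibre_const, Fin.init_snoc, Fin.snoc_last]
  exact ⟨fun h => h.2, fun h => ⟨hx, h⟩⟩

/-- Graph values of the constant term. [cite: KontsevichZagier2001, §1.1] -/
theorem gval_const {x : Fin n → ℝ} (hx : x ∈ r.domain) : (const K r).gval q x = r.integrand x := by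
  have h : ∃ t : ℝ, Fin.snoc x t ∈ (const K r).gfibre q :=
    ⟨r.integrand x, (snoc_mem_gfibre_const r q hx _).2 rfl⟩
  exact (snoc_mem_gfibre_const r q hx _).1 (gval_spec h)

/-- The constant term of a BOUNDED representation is admissible everywhere.
[cite: KontsevichZagier2001, §1.1] -/
theorem adm_const (hr : SoloInformedBddRep r) : (const K r).SoloInformedAdm q := by
  obtain ⟨M, hM₁, hM₂⟩ := hr
  refine ⟨fun x hx => ?_, M, fun x hx => hM₁ x (by simpa using hx), fun x hx t ht => ?_⟩
  · rw [fibre_const] at hx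
    exact ⟨⟨r.integrand x, (snoc_mem_gfibre_const r q hx _).2 rfl⟩, fun t t' ht ht' => by
      rw [(snoc_mem_gfibre_const r q hx t).1 ht, (snoc_mem_gfibre_const r q hx t').1 ht']⟩
  · rw [fibre_const] at hx
    rw [(snoc_mem_gfibre_const r q hx t).1 ht]
    exact hM₂ x hx

/-- **The constant term denotes `r ⊗ ℝ` at every parameter.** [cite: KontsevichZagier2001, §1.1] -/
theorem rep_const (hr : SoloInformedBddRep r) : (const K r).rep q = r.baseChange ℝ :=
  rep_eq_of_graph _ (fibre_const r q).symm (fun x hx t => by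
    rw [fibre_const] at hx
    exact snoc_mem_gfibre_const r q hx t) (fun _ _ => rfl) (adm_const r q hr).2

/-- **A term pinned to a constant term is frozen**: if `T` denotes `r ⊗ ℝ` at `p₀` and coincides
with `const K r` at `p`, it denotes `r ⊗ ℝ` at `p` too. [cite: KontsevichZagier2001, §1.1] -/
theorem rep_eq_of_coin_const {T : SoloInformedPTerm K n} (hr : SoloInformedBddRep r)
    (hT : T.SoloInformedAdm p) (hT₀ : T.SoloInformedAdm p₀) (h₀ : T.rep p₀ = r.baseChange ℝ)
    (h : T.SoloInformedCoin (const K r) p) : T.rep p = r.baseChange ℝ := by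
  rw [← h₀]
  refine rep_eq_of_coin_rigid hT hT₀ (adm_const r p hr) (adm_const r p₀ hr)
    (by rw [fibre_const, fibre_const]) (fun x hx => ?_) (by rw [h₀, rep_const r p₀ hr]) h
  rw [fibre_const] at hx
  rw [gval_const r p hx, gval_const r p₀ hx]

/-! ### The rectangle term -/

/-- **Rectangle term**: at `p` it denotes `[[0,1] × [0, p kℓ], 1]`.
[cite: KontsevichZagier2001, §1.1] -/
def rectTerm (kℓ : K) : SoloInformedPTerm K 2 where
  S := {w | (aeval w (0 : MvPolynomial (K ⊕ Fin 2) ℚ) ≤ aeval w (X (Sum.inr 0)) ∧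
      aeval w (X (Sum.inr 0) : MvPolynomial (K ⊕ Fin 2) ℚ) ≤ aeval w 1) ∧
    (aeval w (0 : MvPolynomial (K ⊕ Fin 2) ℚ) ≤ aeval w (X (Sum.inr 1)) ∧
      aeval w (X (Sum.inr 1) : MvPolynomial (K ⊕ Fin 2) ℚ) ≤ aeval w (X (Sum.inl kℓ)))}
  G := {w | aeval w (X (Sum.inr (Fin.last 2)) - 1 : MvPolynomial (K ⊕ Fin 3) ℚ) = 0}
  φ := fun _ => 1
  hS := ((isSemialgebraic_setOf_eval_le _ _).inter (isSemialgebraic_setOf_eval_le _ _)).inter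
    ((isSemialgebraic_setOf_eval_le _ _).inter (isSemialgebraic_setOf_eval_le _ _))
  hG := isSemialgebraic_setOf_eval_eq_zero _

variable (kℓ : K)

/-- Fibres of the rectangle term. [cite: KontsevichZagier2001, §1.1] -/
@[simp] theorem fibre_rectTerm : (rectTerm kℓ).fibre q = (soloInformedRealRect (q kℓ)).domain := by
  ext x
  rw [soloInformed_mem_rect_domain_iff, mem_fibre]
  simp only [rectTerm, mem_setOf_eq, map_zero, aeval_X, map_one, Sum.elim_inr, Sum.elim_inl]

/-- Graph fibres of the rectangle term. [cite: KontsevichZagier2001, §1.1] -/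
theorem mem_gfibre_rectTerm (z : Fin 3 → ℝ) : z ∈ (rectTerm kℓ).gfibre q ↔ z (Fin.last 2) = 1 := by
  rw [mem_gfibre]
  simp only [rectTerm, mem_setOf_eq, map_sub, aeval_X, map_one, Sum.elim_inr, sub_eq_zero]

/-- Graph fibres of the rectangle term over a point. [cite: KontsevichZagier2001, §1.1] -/
theorem snoc_mem_gfibre_rectTerm (x : Fin 2 → ℝ) (t : ℝ) :
    Fin.snoc x t ∈ (rectTerm kℓ).gfibre q ↔ t = 1 := by
  rw [mem_gfibre_rectTerm, Fin.snoc_last]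

/-- The rectangle term is admissible everywhere. [cite: KontsevichZagier2001, §1.1] -/
theorem adm_rectTerm : (rectTerm kℓ).SoloInformedAdm q := by
  refine ⟨fun x _ => ⟨⟨1, (snoc_mem_gfibre_rectTerm q kℓ x 1).2 rfl⟩, fun t t' ht ht' => by
    rw [(snoc_mem_gfibre_rectTerm q kℓ x t).1 ht, (snoc_mem_gfibre_rectTerm q kℓ x t').1 ht']⟩,
    max 1 |q kℓ|, fun x hx i => ?_, fun x _ t ht => ?_⟩
  · obtain ⟨M, hM, -⟩ := soloInformedBddRep_rect (q kℓ)
    rw [fibre_rectTerm] at hx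
    rw [soloInformed_mem_rect_domain_iff] at hx
    fin_cases i
    · simpa [abs_of_nonneg hx.1.1] using Or.inl hx.1.2
    · have h1 : |x 1| ≤ |q kℓ| := by
        rw [abs_of_nonneg hx.2.1]; exact hx.2.2.trans (le_abs_self _)
      simpa using Or.inr h1
  · rw [(snoc_mem_gfibre_rectTerm q kℓ x t).1 ht]
    simp

/-- **The rectangle term denotes the rectangle.** [cite: KontsevichZagier2001, §1.1] -/
theorem rep_rectTerm : (rectTerm kℓ).rep q = soloInformedRealRect (q kℓ) :=
  rep_eq_of_graph _ (fibre_rectTerm q kℓ).symm (fun x _ t => by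
    rw [snoc_mem_gfibre_rectTerm, soloInformedRealRect_integrand]) (fun _ _ => rfl)
    (adm_rectTerm q kℓ).2

end SoloInformedPTerm

end Summit.KontsevichZagierPeriods.KontsevichZagierPeriods.Theorems
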